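import Literature.Analysis.FluidPDE.ForwardDSSExtension
import HarnessLib

/-!
# A DSS germ near the blow-up time extends uniquely to a globally discretely self-similar field

Summit `NavierStokesRegularity`, cell topic directory `FluidComputer`, namespace
`…FluidComputer.SelfSimilarCensus`; zone Z7 of the D-0081 profile search. PURE SCALING, any normed
spaces `E`, `F` over `ℝ`; no equation. An exact discretely self-similar blow-up object is usually
only given on a terminal time interval `(T₁, 0)` before the blow-up time `0` (e.g. the periodic-
profile object of `PeriodicProfileSingularPoint.lean`: `nsRescale c u t = u t` for `t ∈ (θ(σ₁), 0)`),
whereas the tree's Liouville-type theorems for discretely self-similar fields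
(`IsDiscretelySelfSimilar c u : nsRescale c u = u`, the `rdssClass_*` floors, Chae–Wolf / Tsai /
Bradshaw–Tsai) speak about GLOBAL (ancient) DSS fields. This file closes that bookkeeping gap: the
germ determines a unique global DSS field, which on every larger terminal interval
`((cᵏ)² T₁, 0)` IS a rescaled copy `nsRescale (c⁻¹)ᵏ u` of the germ — so every scaling-covariant,
time-local solution notion transfers to the extension (classical solutions:
`DssGermAncientClassicalSolution.lean`). PROVED theorems only; no definitions, no named facts.

## Setting and content

`c > 1`, `T₁ < 0`. The GERM RELATION for a velocity-type field `u : ℝ → E → F` is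
`nsRescale c⁻¹ u t = u t` for `t ∈ (T₁, 0)`, i.e. `u(t, x) = c⁻¹ u(t/c², c⁻¹x)` — both times lie
in `(T₁, 0)`, so this constrains the germ only (it is the relation `u(t/c², y) = c u(t, c y)` of
`periodicProfile_dss_Ioo` with `T = 0`). For a pressure-type field `p : ℝ → E → ℝ` the relation is
`nsRescalePressure c⁻¹ p t = p t`.

* §1 `nsRescale_inv_pow_eq_of_germ` (iterating inside the germ: `nsRescale (c⁻¹)ᵏ u t = u t` on
  `(T₁, 0)`), `nsRescale_inv_pow_add_eq_of_germ` (CONSISTENCY: the candidate values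
  `nsRescale (c⁻¹)ᵏ u t` agree for all admissible `k`, i.e. all `k` with `(c⁻¹)²ᵏ t ∈ (T₁, 0)`),
  `exists_admissible_of_neg` (every `t < 0` has an admissible `k`).
* §2 **`exists_dss_extension`** — there is `ũ : ℝ → E → F` with `IsDiscretelySelfSimilar c ũ`,
  `ũ t = u t` for `t ∈ (T₁, 0)`, `ũ t = nsRescale (c⁻¹)ᵏ u t` whenever `(c⁻¹)²ᵏ t ∈ (T₁, 0)`, and
  `ũ t = 0` for `t ≥ 0`; **`dss_extension_unique`** — two globally `c`-DSS fields that agree on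
  `(T₁, 0)` agree on `t < 0`.
* §3 the same for pressures: `nsRescalePressure_inv_pow_eq_of_germ`,
  `nsRescalePressure_inv_pow_add_eq_of_germ`, **`exists_dssPressure_extension`**.

READING for the Z7 row (lead's pen): an exact DSS blow-up germ on a terminal slab IS the terminal
piece of an ancient DSS field, uniquely; «local exact DSS object» and «ancient DSS object» are the
same census entry, and the (K-a) kernel floors about the continuum (R)DSS class address it once the
solution class (mild / suitable / classical) is transported — classical: the companion file.

WHAT THIS IS NOT: not an existence claim for DSS solutions, not Navier–Stokes evidence; «violates:
none — no object». Tree search: `lean search 'IsDiscretelySelfSimilar|extension'` —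
`BradshawTsai2019.extension` (`ForwardDSSExtension`: a GLOBALLY DSS pair that solves NS near the
origin solves it on the FORWARD slab — the relation is assumed global there),
`isDiscretelySelfSimilar_pow` / `_inv` (reused here); nothing constructing the global field from a
germ.

References: Z. Bradshaw, T.-P. Tsai, Analysis & PDE 12 (2019), §4.2 (extension principle, forward
case) [BradshawTsai2019]; D. Chae, J. Wolf, ARMA 225 (2017), Def. 1.1 [ChaeWolf2017RemovingDSS].
-/

noncomputable section

open Set Filter Topology Function

namespace Summit.NavierStokesRegularity.FluidComputer.SelfSimilarCensus

open Literature.Analysis.FluidPDE Literature.Analysis.FluidPDE.BradshawTsai2019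

section Germ

variable {E : Type*} [NormedAddCommGroup E] [NormedSpace ℝ E]
variable {F : Type*} [NormedAddCommGroup F] [NormedSpace ℝ F]
variable {u : ℝ → E → F} {p : ℝ → E → ℝ} {c T₁ : ℝ}

/-! ### §0 Admissible indices: `(c⁻¹)²ᵏ t ∈ (T₁, 0)` -/

/-- One germ step stays in the germ interval: `t ∈ (T₁, 0)`, `c > 1` ⇒ `c⁻² t ∈ (T₁, 0)`
(closer to the blow-up time). [folklore] -/
theorem inv_sq_mul_mem_Ioo (hc : 1 < c) {t : ℝ} (ht : t ∈ Ioo T₁ 0) :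
    c⁻¹ ^ 2 * t ∈ Ioo T₁ 0 := by
  have hc0 : 0 < c := zero_lt_one.trans hc
  have h1 : c⁻¹ ^ 2 < 1 := by
    rw [inv_pow]; exact inv_lt_one_of_one_lt₀ (by nlinarith)
  have h2 : 0 < c⁻¹ ^ 2 := by positivity
  refine ⟨?_, by nlinarith [ht.2]⟩
  nlinarith [ht.1, ht.2]

/-- Admissibility is inherited by larger indices: if `(c⁻¹)²ᵏ t ∈ (T₁, 0)` then
`(c⁻¹)²⁽ʲ⁺ᵏ⁾ t ∈ (T₁, 0)`. [folklore] -/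
theorem inv_pow_sq_mul_mem_Ioo_add (hc : 1 < c) {t : ℝ} {k : ℕ}
    (ht : (c⁻¹ ^ k) ^ 2 * t ∈ Ioo T₁ 0) (j : ℕ) : (c⁻¹ ^ (j + k)) ^ 2 * t ∈ Ioo T₁ 0 := by
  induction j with
  | zero => simpa using ht
  | succ j ih =>
    have h := inv_sq_mul_mem_Ioo hc ih
    have e : c⁻¹ ^ 2 * ((c⁻¹ ^ (j + k)) ^ 2 * t) = (c⁻¹ ^ (j + 1 + k)) ^ 2 * t := by ring
    rwa [e] at h

/-- **Every time before the blow-up time is reached**: for `t < 0` (`T₁ < 0`, `c > 1`) some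
`k : ℕ` has `(c⁻¹)²ᵏ t ∈ (T₁, 0)` (`(c⁻¹)²ᵏ t → 0⁻`). [folklore] -/
theorem exists_admissible_of_neg (hc : 1 < c) (hT₁ : T₁ < 0) {t : ℝ} (ht : t < 0) :
    ∃ k : ℕ, (c⁻¹ ^ k) ^ 2 * t ∈ Ioo T₁ 0 := by
  have hc0 : 0 < c := zero_lt_one.trans hc
  have hlt : c⁻¹ ^ 2 < 1 := by
    rw [inv_pow]; exact inv_lt_one_of_one_lt₀ (by nlinarith)
  have hlim : Tendsto (fun k : ℕ => (c⁻¹ ^ 2) ^ k * t) atTop (𝓝 (0 * t)) :=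
    (tendsto_pow_atTop_nhds_zero_of_lt_one (by positivity) hlt).mul_const t
  rw [zero_mul] at hlim
  obtain ⟨k, hk⟩ := (hlim.eventually (lt_mem_nhds hT₁)).exists
  refine ⟨k, ?_, ?_⟩
  · have e : (c⁻¹ ^ k) ^ 2 * t = (c⁻¹ ^ 2) ^ k * t := by ring
    rwa [e]
  · have : 0 < (c⁻¹ ^ k) ^ 2 := by positivity
    nlinarith

/-! ### §1 Iterating and consistency inside the germ (velocity-type fields) -/

/-- **Iterating the germ relation.** If `nsRescale c⁻¹ u t = u t` for every `t ∈ (T₁, 0)`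
(`c > 1`), then `nsRescale (c⁻¹)ᵏ u t = u t` for every `t ∈ (T₁, 0)` and every `k : ℕ` — each
step reads `u` one factor `c⁻²` closer to the blow-up time, inside the germ interval. [folklore] -/
theorem nsRescale_inv_pow_eq_of_germ (hc : 1 < c)
    (hu : ∀ t ∈ Ioo T₁ 0, nsRescale c⁻¹ u t = u t) (k : ℕ) :
    ∀ t ∈ Ioo T₁ 0, nsRescale (c⁻¹ ^ k) u t = u t := by
  induction k with
  | zero => intro t _; rw [pow_zero, nsRescale_one]
  | succ k ih =>
    intro t ht
    rw [pow_succ, nsRescale_mul]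
    funext x
    rw [nsRescale_apply, ih _ (inv_sq_mul_mem_Ioo hc ht), ← nsRescale_apply, hu t ht]

/-- **Consistency of the candidate values.** If `nsRescale c⁻¹ u = u` on `(T₁, 0)` and
`(c⁻¹)²ᵏ t ∈ (T₁, 0)`, then `nsRescale (c⁻¹)ʲ⁺ᵏ u t = nsRescale (c⁻¹)ᵏ u t` for every `j`: all
admissible indices give the same value at `t`. [folklore] -/
theorem nsRescale_inv_pow_add_eq_of_germ (hc : 1 < c)
    (hu : ∀ t ∈ Ioo T₁ 0, nsRescale c⁻¹ u t = u t) {t : ℝ} {k : ℕ}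
    (ht : (c⁻¹ ^ k) ^ 2 * t ∈ Ioo T₁ 0) (j : ℕ) :
    nsRescale (c⁻¹ ^ (j + k)) u t = nsRescale (c⁻¹ ^ k) u t := by
  funext x
  rw [pow_add, nsRescale_mul, nsRescale_apply, nsRescale_inv_pow_eq_of_germ hc hu j _ ht,
    ← nsRescale_apply]

/-- Consistency, symmetric form: any two admissible indices give the same value. [folklore] -/
theorem nsRescale_inv_pow_eq_of_admissible (hc : 1 < c)
    (hu : ∀ t ∈ Ioo T₁ 0, nsRescale c⁻¹ u t = u t) {t : ℝ} {j k : ℕ}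
    (hj : (c⁻¹ ^ j) ^ 2 * t ∈ Ioo T₁ 0) (hk : (c⁻¹ ^ k) ^ 2 * t ∈ Ioo T₁ 0) :
    nsRescale (c⁻¹ ^ j) u t = nsRescale (c⁻¹ ^ k) u t := by
  rcases le_total k j with h | h
  · obtain ⟨i, rfl⟩ := Nat.exists_eq_add_of_le h
    rw [add_comm]
    exact nsRescale_inv_pow_add_eq_of_germ hc hu hk i
  · obtain ⟨i, rfl⟩ := Nat.exists_eq_add_of_le h
    rw [add_comm]
    exact (nsRescale_inv_pow_add_eq_of_germ hc hu hj i).symm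

/-! ### §2 The global extension and its uniqueness (velocity-type fields) -/

/-- **A DSS GERM EXTENDS TO A GLOBALLY DSS FIELD.** Let `c > 1`, `T₁ < 0`, and let
`u : ℝ → E → F` satisfy the germ relation `nsRescale c⁻¹ u t = u t` for `t ∈ (T₁, 0)`. Then there
is `ũ : ℝ → E → F` with: `IsDiscretelySelfSimilar c ũ` (the tree's global relation
`nsRescale c ũ = ũ`); `ũ t = u t` for `t ∈ (T₁, 0)`; the REPRESENTATION `ũ t = nsRescale (c⁻¹)ᵏ u t`
whenever `(c⁻¹)²ᵏ t ∈ (T₁, 0)` — so on each terminal interval `((cᵏ)² T₁, 0)` the extension is a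
rescaled copy of the germ; and `ũ t = 0` for `t ≥ 0` (the relation only links times of the same
sign; the extension is declared trivial from the blow-up time on). [folklore] -/
theorem exists_dss_extension (hc : 1 < c) (hT₁ : T₁ < 0)
    (hu : ∀ t ∈ Ioo T₁ 0, nsRescale c⁻¹ u t = u t) :
    ∃ v : ℝ → E → F, IsDiscretelySelfSimilar c v ∧ (∀ t ∈ Ioo T₁ 0, v t = u t) ∧
      (∀ (k : ℕ) (t : ℝ), (c⁻¹ ^ k) ^ 2 * t ∈ Ioo T₁ 0 → v t = nsRescale (c⁻¹ ^ k) u t) ∧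
      ∀ t, 0 ≤ t → v t = 0 := by
  classical
  have hc0 : 0 < c := zero_lt_one.trans hc
  -- the extension: at `t < 0` use any admissible index (well defined by consistency)
  set v : ℝ → E → F := fun t =>
    if ht : t < 0 then nsRescale (c⁻¹ ^ (exists_admissible_of_neg hc hT₁ ht).choose) u t else 0
    with hv
  have hrep : ∀ (k : ℕ) (t : ℝ), (c⁻¹ ^ k) ^ 2 * t ∈ Ioo T₁ 0 → v t = nsRescale (c⁻¹ ^ k) u t := by
    intro k t ht
    have htneg : t < 0 := by
      have : 0 < (c⁻¹ ^ k) ^ 2 := by positivity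
      nlinarith [ht.2]
    have hdef : v t = nsRescale (c⁻¹ ^ (exists_admissible_of_neg hc hT₁ htneg).choose) u t := by
      simp only [hv, dif_pos htneg]
    rw [hdef]
    exact nsRescale_inv_pow_eq_of_admissible hc hu (exists_admissible_of_neg hc hT₁ htneg).choose_spec ht
  have hzero : ∀ t, 0 ≤ t → v t = 0 := fun t ht => by simp only [hv, dif_neg (not_lt.2 ht)]
  refine ⟨v, ?_, fun t ht => ?_, hrep, hzero⟩
  · -- global DSS: first `nsRescale c⁻¹ v = v`, then invert
    have hinv : nsRescale c⁻¹ v = v := by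
      funext t x
      by_cases ht : t < 0
      · obtain ⟨k, hk⟩ := exists_admissible_of_neg hc hT₁ ht
        have hk' : (c⁻¹ ^ k) ^ 2 * (c⁻¹ ^ 2 * t) ∈ Ioo T₁ 0 := by
          have := inv_sq_mul_mem_Ioo hc hk
          have e : c⁻¹ ^ 2 * ((c⁻¹ ^ k) ^ 2 * t) = (c⁻¹ ^ k) ^ 2 * (c⁻¹ ^ 2 * t) := by ring
          rwa [e] at this
        have hk1 : (c⁻¹ ^ (1 + k)) ^ 2 * t ∈ Ioo T₁ 0 := inv_pow_sq_mul_mem_Ioo_add hc hk 1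
        rw [nsRescale_apply, hrep k _ hk', ← nsRescale_apply, ← nsRescale_mul, ← pow_succ,
          hrep (1 + k) t hk1, add_comm]
      · have ht0 : 0 ≤ t := not_lt.1 ht
        have ht2 : 0 ≤ c⁻¹ ^ 2 * t := mul_nonneg (by positivity) ht0
        rw [nsRescale_apply, hzero _ ht2, hzero _ ht0]
        simp
    unfold IsDiscretelySelfSimilar
    have h := congrArg (nsRescale c) hinv
    rw [← nsRescale_mul, inv_mul_cancel₀ hc0.ne', nsRescale_one] at h
    exact h.symm
  · have h := hrep 0 t (by simpa using ht)
    rwa [pow_zero, nsRescale_one] at h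

/-- **UNIQUENESS OF THE EXTENSION.** Two globally `c`-DSS fields (`c > 1`) that agree on a
terminal interval `(T₁, 0)`, `T₁ < 0`, agree at every `t < 0`: the germ determines the ancient
field. (`nsRescale (c⁻¹)ᵏ v = v` for both, and `(c⁻¹)²ᵏ t ∈ (T₁, 0)` for `k` large.) [folklore] -/
theorem dss_extension_unique (hc : 1 < c) (hT₁ : T₁ < 0) {v w : ℝ → E → F}
    (hv : IsDiscretelySelfSimilar c v) (hw : IsDiscretelySelfSimilar c w)
    (heq : ∀ t ∈ Ioo T₁ 0, v t = w t) : ∀ t < 0, v t = w t := by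
  intro t ht
  have hc0 : 0 < c := zero_lt_one.trans hc
  obtain ⟨k, hk⟩ := exists_admissible_of_neg hc hT₁ ht
  have hv' : nsRescale (c⁻¹ ^ k) v = v := isDiscretelySelfSimilar_pow (isDiscretelySelfSimilar_inv hc0.ne' hv) k
  have hw' : nsRescale (c⁻¹ ^ k) w = w := isDiscretelySelfSimilar_pow (isDiscretelySelfSimilar_inv hc0.ne' hw) k
  funext x
  rw [← hv', ← hw', nsRescale_apply, nsRescale_apply, heq _ hk]

/-! ### §3 The same for pressure-type fields (`nsRescalePressure`, weight `c²`) -/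

/-- Iterating the pressure germ relation: `nsRescalePressure (c⁻¹)ᵏ p t = p t` on `(T₁, 0)`.
[folklore] -/
theorem nsRescalePressure_inv_pow_eq_of_germ (hc : 1 < c)
    (hp : ∀ t ∈ Ioo T₁ 0, nsRescalePressure c⁻¹ p t = p t) (k : ℕ) :
    ∀ t ∈ Ioo T₁ 0, nsRescalePressure (c⁻¹ ^ k) p t = p t := by
  induction k with
  | zero => intro t _; rw [pow_zero, nsRescalePressure_one]
  | succ k ih =>
    intro t ht
    rw [pow_succ, nsRescalePressure_mul]
    funext x
    rw [nsRescalePressure_apply, ih _ (inv_sq_mul_mem_Ioo hc ht), ← nsRescalePressure_apply, hp t ht]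

/-- Consistency of the pressure candidates: `nsRescalePressure (c⁻¹)ʲ⁺ᵏ p t = nsRescalePressure (c⁻¹)ᵏ p t`
whenever `(c⁻¹)²ᵏ t ∈ (T₁, 0)`. [folklore] -/
theorem nsRescalePressure_inv_pow_add_eq_of_germ (hc : 1 < c)
    (hp : ∀ t ∈ Ioo T₁ 0, nsRescalePressure c⁻¹ p t = p t) {t : ℝ} {k : ℕ}
    (ht : (c⁻¹ ^ k) ^ 2 * t ∈ Ioo T₁ 0) (j : ℕ) :
    nsRescalePressure (c⁻¹ ^ (j + k)) p t = nsRescalePressure (c⁻¹ ^ k) p t := by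
  funext x
  rw [pow_add, nsRescalePressure_mul, nsRescalePressure_apply,
    nsRescalePressure_inv_pow_eq_of_germ hc hp j _ ht, ← nsRescalePressure_apply]

/-- Consistency of the pressure candidates, symmetric form. [folklore] -/
theorem nsRescalePressure_inv_pow_eq_of_admissible (hc : 1 < c)
    (hp : ∀ t ∈ Ioo T₁ 0, nsRescalePressure c⁻¹ p t = p t) {t : ℝ} {j k : ℕ}
    (hj : (c⁻¹ ^ j) ^ 2 * t ∈ Ioo T₁ 0) (hk : (c⁻¹ ^ k) ^ 2 * t ∈ Ioo T₁ 0) :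
    nsRescalePressure (c⁻¹ ^ j) p t = nsRescalePressure (c⁻¹ ^ k) p t := by
  rcases le_total k j with h | h
  · obtain ⟨i, rfl⟩ := Nat.exists_eq_add_of_le h
    rw [add_comm]
    exact nsRescalePressure_inv_pow_add_eq_of_germ hc hp hk i
  · obtain ⟨i, rfl⟩ := Nat.exists_eq_add_of_le h
    rw [add_comm]
    exact (nsRescalePressure_inv_pow_add_eq_of_germ hc hp hj i).symm

/-- **A DSS PRESSURE GERM EXTENDS TO A GLOBALLY DSS PRESSURE**: there is `q` with
`nsRescalePressure c q = q`, `q t = p t` on `(T₁, 0)`, `q t = nsRescalePressure (c⁻¹)ᵏ p t` whenever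
`(c⁻¹)²ᵏ t ∈ (T₁, 0)`, and `q t = 0` for `t ≥ 0`. [folklore] -/
theorem exists_dssPressure_extension (hc : 1 < c) (hT₁ : T₁ < 0)
    (hp : ∀ t ∈ Ioo T₁ 0, nsRescalePressure c⁻¹ p t = p t) :
    ∃ q : ℝ → E → ℝ, nsRescalePressure c q = q ∧ (∀ t ∈ Ioo T₁ 0, q t = p t) ∧
      (∀ (k : ℕ) (t : ℝ), (c⁻¹ ^ k) ^ 2 * t ∈ Ioo T₁ 0 → q t = nsRescalePressure (c⁻¹ ^ k) p t) ∧
      ∀ t, 0 ≤ t → q t = 0 := by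
  classical
  have hc0 : 0 < c := zero_lt_one.trans hc
  set q : ℝ → E → ℝ := fun t =>
    if ht : t < 0 then nsRescalePressure (c⁻¹ ^ (exists_admissible_of_neg hc hT₁ ht).choose) p t
    else 0 with hq
  have hrep : ∀ (k : ℕ) (t : ℝ), (c⁻¹ ^ k) ^ 2 * t ∈ Ioo T₁ 0 →
      q t = nsRescalePressure (c⁻¹ ^ k) p t := by
    intro k t ht
    have htneg : t < 0 := by
      have : 0 < (c⁻¹ ^ k) ^ 2 := by positivity
      nlinarith [ht.2]
    have hdef : q t = nsRescalePressure (c⁻¹ ^ (exists_admissible_of_neg hc hT₁ htneg).choose) p t := by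
      simp only [hq, dif_pos htneg]
    rw [hdef]
    exact nsRescalePressure_inv_pow_eq_of_admissible hc hp
      (exists_admissible_of_neg hc hT₁ htneg).choose_spec ht
  have hzero : ∀ t, 0 ≤ t → q t = 0 := fun t ht => by simp only [hq, dif_neg (not_lt.2 ht)]
  refine ⟨q, ?_, fun t ht => ?_, hrep, hzero⟩
  · have hinv : nsRescalePressure c⁻¹ q = q := by
      funext t x
      by_cases ht : t < 0
      · obtain ⟨k, hk⟩ := exists_admissible_of_neg hc hT₁ ht
        have hk' : (c⁻¹ ^ k) ^ 2 * (c⁻¹ ^ 2 * t) ∈ Ioo T₁ 0 := by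
          have := inv_sq_mul_mem_Ioo hc hk
          have e : c⁻¹ ^ 2 * ((c⁻¹ ^ k) ^ 2 * t) = (c⁻¹ ^ k) ^ 2 * (c⁻¹ ^ 2 * t) := by ring
          rwa [e] at this
        have hk1 : (c⁻¹ ^ (1 + k)) ^ 2 * t ∈ Ioo T₁ 0 := inv_pow_sq_mul_mem_Ioo_add hc hk 1
        rw [nsRescalePressure_apply, hrep k _ hk', ← nsRescalePressure_apply, ← nsRescalePressure_mul,
          ← pow_succ, hrep (1 + k) t hk1, add_comm]
      · have ht0 : 0 ≤ t := not_lt.1 ht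
        have ht2 : 0 ≤ c⁻¹ ^ 2 * t := mul_nonneg (by positivity) ht0
        rw [nsRescalePressure_apply, hzero _ ht2, hzero _ ht0]
        simp
    have h := congrArg (nsRescalePressure c) hinv
    rw [← nsRescalePressure_mul, inv_mul_cancel₀ hc0.ne', nsRescalePressure_one] at h
    exact h.symm
  · have h := hrep 0 t (by simpa using ht)
    rwa [pow_zero, nsRescalePressure_one] at h

end Germ

end Summit.NavierStokesRegularity.FluidComputer.SelfSimilarCensus

end
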